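import Summits.ResolutionOfSingularities.ResolutionOfSingularities.Theorems.WildConesCampaignW46HypersurfacesCharTwoFreePoints
import Summits.ResolutionOfSingularities.ResolutionOfSingularities.Theorems.WildConesCampaignW46HypersurfacesCharTwoCubicPolarization
import Summits.ResolutionOfSingularities.ResolutionOfSingularities.Theorems.WildConesCampaignW46HypersurfacesCharTwoHilbertWitness
import Summits.ResolutionOfSingularities.ResolutionOfSingularities.Theorems.WildConesCampaignW46HypersurfacesCharTwoDFour

/-!
# [OURS · L1 W4.6, rung (ii) at p = 2, EVERY dimension n] THE SATELLITE SPINE: over a perfect field of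
# characteristic 2, an isolated double point of the multiple-tangent class `(e, h₂) = (2, 2)` of
# `z² = a(u₁,…,uₙ)` has a FORCED chain of satellite blow-ups `c₀ → c₁ → ⋯ → c_k` (each `c_m`, `m < k`,
# again `(2,2)`, isolated, `μ` strictly decreasing), ending at the first `c_k` with `h₂ ∈ {1, 3}`;
# every other infinitely-near double point along the way is a free leaf; `k + 4 ≤ μ(c₀)`

HONEST FRAMING. Everything here is OURS: theorems about route WildCones' own TYPED point-blow-up dynamics
(`Theorems/WildConesClassicalRegimesDefs.lean`: `step`, `run`) and the seat's invariants `milnorEmbDim`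
(p498937), `milnorHilbertTwo` (p511581), `polarMatrix` (p502936), `degForm` (p522667). NOTHING here is a
statement of the manuscript [Hironaka2017]; no FACT-LIST premise; AI review is weaker than expert review.
Cell res-hironaka (LADDER-RESOLUTION rung L, D-0089), slot W4.6, seat res-L1-s46-pv-4 (gen 6); host route
`WildCones`, crux `ClassicalRegimes` (stmt-ResolutionOfSingularities-16884; proved).

THE PICTURE (assembled from gens 4–6). At an isolated corank-two double point with `h₂ = 2` over a
PERFECT field: exactly one near point is a satellite (p538084 / p536239), its successor is again an
isolated corank-two double point with smaller `μ` (gen 4's isolatedness transfer), and every other near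
double point is free (corank `0`, `μ = 1`, nothing after it; at most one, p544683). Iterating while the
class stays `(2,2)`: the chain of satellites is FORCED and, `μ` decreasing, finite; it stops at the first
node whose `h₂` is `1` (three tangents: `μ = 4` exactly, at most three free leaves and nothing else —
p517564, p543928) or `3` (no tangent cubic: a whole kernel line of NON-isolated double successors — the
sideways exit of gen 4). So the tree of infinitely-near double points above `c₀` under point blow-ups,
as long as it consists of isolated points, is a CATERPILLAR: the satellite spine with at most one free
leaf at each `(2,2)` node, ending in a `D₄` node with `≤ 3` free leaves or in a `(2,3)` node.

WHAT IS PROVED (every `n`, perfect fields of characteristic `2` for the spine; any field for the rest):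

* `run_succ` — `run c₀ i t (m+1) = step (i m) (t m) (run c₀ i t m)` (definitional);
* `hypersurface_satellite_spine` — **THE SPINE**: words `i, t` and a length `k ≥ 1` with: `run m`
  (`m ≤ k`) a double point, isolated, corank `2`; `h₂(run m) = 2` and `μ(run (m+1)) < μ(run m)` for
  `m < k`; `h₂(run k) ∈ {1, 3}`; `k + 4 ≤ μ(c₀)`;
* `hypersurface_spine_node_census` — at every `(2,2)` isolated node, each double successor is the
  satellite (corank `2`, near vector proportional to any other corank-two successor's) or a free leaf;
* `hypersurface_spine_end` — the end node: `h₂ = 1` ⇒ `μ = 4`, at most three near double points, all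
  free leaves; `h₂ = 3` ⇒ every double successor is NON-isolated and every kernel direction is one.

References: [CasasAlvero2000] §3 (free/satellite points, proximity: context only); [GreuelPfister2026]
(context); [Hironaka2017] Th. 16.6 p.84 — role replaced only, under adjudication; nothing of it is used.
-/

noncomputable section

-- single-problem summit: the doubled namespace component `ResolutionOfSingularities` is forced
set_option linter.dupNamespace false

open scoped BigOperators Classical

open MvPowerSeries IsLocalRing

open Literature.AlgebraicGeometry.Resolution

namespace Summit.ResolutionOfSingularities.ResolutionOfSingularities.Theorems

namespace CampaignW46.HypersurfacesCharTwo

open WildCones WildCones.MuDropCharTwoOrdP ThreefoldsCharTwo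

variable {κ : Type} [Field κ] {n : ℕ}

/-! ## Runs -/

/-- [OURS · L1 W4.6] One more step of a run: `run c₀ i t (m+1) = step (i m) (t m) (run c₀ i t m)`.
[folklore] -/
theorem run_succ (p : ℕ) (c₀ : (Fin n → ℕ) → κ) (i : ℕ → Fin n) (t : ℕ → Fin n → κ) (m : ℕ) :
    run p n κ c₀ i t (m + 1) = step p n κ (i m) (t m) (run p n κ c₀ i t m) := rfl

/-- [OURS · L1 W4.6] The run of length zero is the start state. [folklore] -/
theorem run_zero (p : ℕ) (c₀ : (Fin n → ℕ) → κ) (i : ℕ → Fin n) (t : ℕ → Fin n → κ) :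
    run p n κ c₀ i t 0 = c₀ := rfl

/-! ## The spine -/

/-- [OURS · L1 W4.6 rung (ii) at `p = 2`, EVERY dimension `n`, PERFECT field; NOT a statement of the
manuscript] **THE SATELLITE SPINE.** Let `c₀` be an isolated double state of `z² = a(u₁,…,uₙ)` over a
perfect field of characteristic `2` with `e(c₀) = 2` and `h₂(c₀) = 2` (multiple tangent). Then there are a
chart word `i`, a translation word `t` and a length `k ≥ 1` such that, writing `c_m = run c₀ i t m`:
every `c_m` (`m ≤ k`) is an isolated double point of corank `2`; for `m < k` the node `c_m` is in the
class `(2,2)` and `μ(c_{m+1}) < μ(c_m)` (each step is the satellite blow-up); the end node has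
`h₂(c_k) = 1` (three tangents) or `h₂(c_k) = 3` (no tangent cubic); and `k + 4 ≤ μ(c₀)`. (Construction:
always step to a chosen corank-two double successor; it exists at `(2,2)` nodes by p538084 and is
isolated with smaller `μ` by gen 4; since `μ` decreases the class `(2,2)` cannot persist forever, and the
first change is to `h₂ ∈ {1,3}` by the range `h₂ ∈ {1,2,3}`.) [folklore] -/
theorem hypersurface_satellite_spine [CharP κ 2] [PerfectField κ] (c₀ : (Fin n → ℕ) → κ)
    (hM₀ : MultP 2 n κ c₀) (hI₀ : Isol 2 n κ c₀) (he₀ : milnorEmbDim 2 n κ c₀ = 2)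
    (hh₀ : milnorHilbertTwo 2 n κ c₀ = 2) :
    ∃ (i : ℕ → Fin n) (t : ℕ → Fin n → κ) (k : ℕ), 1 ≤ k ∧ k + 4 ≤ mu 2 n κ c₀ ∧
      (∀ m ≤ k, MultP 2 n κ (run 2 n κ c₀ i t m) ∧ Isol 2 n κ (run 2 n κ c₀ i t m) ∧
        milnorEmbDim 2 n κ (run 2 n κ c₀ i t m) = 2) ∧
      (∀ m < k, milnorHilbertTwo 2 n κ (run 2 n κ c₀ i t m) = 2 ∧
        milnorEmbDim 2 n κ (run 2 n κ c₀ i t (m + 1)) = 2 ∧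
        mu 2 n κ (run 2 n κ c₀ i t (m + 1)) < mu 2 n κ (run 2 n κ c₀ i t m)) ∧
      (milnorHilbertTwo 2 n κ (run 2 n κ c₀ i t k) = 1 ∨ milnorHilbertTwo 2 n κ (run 2 n κ c₀ i t k) = 3) := by
  classical
  -- `n ≠ 0`: a corank-two state has at least two variables
  have hn : 0 < n := by
    have h := (milnorEmbDim_le_and_mod_two hM₀).1
    rw [he₀] at h
    omega
  have i₀ : Fin n := ⟨0, hn⟩
  -- a choice of a corank-two double successor whenever one exists
  let nxt : ((Fin n → ℕ) → κ) → Fin n × (Fin n → κ) := fun c =>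
    if h : ∃ x : Fin n × (Fin n → κ), MultP 2 n κ (step 2 n κ x.1 x.2 c) ∧
        milnorEmbDim 2 n κ (step 2 n κ x.1 x.2 c) = 2 then h.choose else (i₀, fun _ => 0)
  have hnxt : ∀ c, (∃ (j : Fin n) (τ : Fin n → κ), MultP 2 n κ (step 2 n κ j τ c) ∧
      milnorEmbDim 2 n κ (step 2 n κ j τ c) = 2) →
      MultP 2 n κ (step 2 n κ (nxt c).1 (nxt c).2 c) ∧ milnorEmbDim 2 n κ (step 2 n κ (nxt c).1 (nxt c).2 c) = 2 := by
    rintro c ⟨j, τ, h⟩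
    have hex : ∃ x : Fin n × (Fin n → κ), MultP 2 n κ (step 2 n κ x.1 x.2 c) ∧
        milnorEmbDim 2 n κ (step 2 n κ x.1 x.2 c) = 2 := ⟨(j, τ), h⟩
    simp only [nxt, dif_pos hex]
    exact hex.choose_spec
  -- the states along the spine, and the words reading them off
  let s : ℕ → (Fin n → ℕ) → κ := fun m => Nat.rec c₀ (fun _ c => step 2 n κ (nxt c).1 (nxt c).2 c) m
  have hs0 : s 0 = c₀ := rfl
  have hsS : ∀ m, s (m + 1) = step 2 n κ (nxt (s m)).1 (nxt (s m)).2 (s m) := fun m => rfl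
  have hrun : ∀ m, run 2 n κ c₀ (fun m => (nxt (s m)).1) (fun m => (nxt (s m)).2) m = s m := by
    intro m
    induction m with
    | zero => rfl
    | succ m ih => rw [run_succ, ih, hsS]
  -- one satellite step from a `(2,2)` isolated node
  have hstep : ∀ c, MultP 2 n κ c → Isol 2 n κ c → milnorEmbDim 2 n κ c = 2 → milnorHilbertTwo 2 n κ c = 2 →
      MultP 2 n κ (step 2 n κ (nxt c).1 (nxt c).2 c) ∧ Isol 2 n κ (step 2 n κ (nxt c).1 (nxt c).2 c) ∧
        milnorEmbDim 2 n κ (step 2 n κ (nxt c).1 (nxt c).2 c) = 2 ∧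
        mu 2 n κ (step 2 n κ (nxt c).1 (nxt c).2 c) < mu 2 n κ c := by
    intro c hM hI he hh
    obtain ⟨j, τ, hM', he', -, -⟩ := hypersurface_satellite_step_of_milnorHilbertTwo_eq_two c hM hI he hh
    obtain ⟨hM'', he''⟩ := hnxt c ⟨j, τ, hM', he'⟩
    obtain ⟨hI'', hμ⟩ := hypersurface_isol_step_of_milnorHilbertTwo_le_two c _ _ hM hI he (by omega) hM''
    exact ⟨hM'', hI'', he'', hμ⟩
  -- while all earlier nodes are `(2,2)`: the invariants propagate and `μ` drops by at least one per step
  have hprop : ∀ m, (∀ j < m, milnorHilbertTwo 2 n κ (s j) = 2) →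
      MultP 2 n κ (s m) ∧ Isol 2 n κ (s m) ∧ milnorEmbDim 2 n κ (s m) = 2 ∧ mu 2 n κ (s m) + m ≤ mu 2 n κ c₀ := by
    intro m
    induction m with
    | zero => intro _; exact ⟨hM₀, hI₀, he₀, by rw [hs0]; omega⟩
    | succ m ih =>
      intro hall
      obtain ⟨hM, hI, he, hμ⟩ := ih fun j hj => hall j (by omega)
      obtain ⟨hM', hI', he', hμ'⟩ := hstep (s m) hM hI he (hall m (by omega))
      rw [hsS]
      exact ⟨hM', hI', he', by omega⟩
  -- the class `(2,2)` cannot persist forever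
  have hex : ∃ m, milnorHilbertTwo 2 n κ (s m) ≠ 2 := by
    by_contra hall
    push Not at hall
    have h := (hprop (mu 2 n κ c₀ + 1) fun j _ => hall j).2.2.2
    omega
  set k := Nat.find hex with hk
  have hk2 : milnorHilbertTwo 2 n κ (s k) ≠ 2 := Nat.find_spec hex
  have hbefore : ∀ j < k, milnorHilbertTwo 2 n κ (s j) = 2 := fun j hj => by
    have h := Nat.find_min hex (hk ▸ hj)
    push Not at h
    exact h
  have hk1 : 1 ≤ k := by
    by_contra h
    have hk0 : k = 0 := by omega
    rw [hk0, hs0] at hk2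
    exact hk2 hh₀
  refine ⟨fun m => (nxt (s m)).1, fun m => (nxt (s m)).2, k, hk1, ?_, fun m hm => ?_, fun m hm => ?_, ?_⟩
  · -- `k + 4 ≤ μ(c₀)`: the end node is isolated of corank two, so `μ ≥ 4`
    obtain ⟨hM, hI, he, hμ⟩ := hprop k hbefore
    have h4 := milnorHilbertTwo_add_le_mu hM hI
    have hr := (milnorHilbertTwo_range hM he).1
    omega
  · rw [hrun]
    obtain ⟨hM, hI, he, -⟩ := hprop m fun j hj => hbefore j (by omega)
    exact ⟨hM, hI, he⟩
  · rw [hrun, hrun, hsS]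
    obtain ⟨hM, hI, he, -⟩ := hprop m fun j hj => hbefore j (by omega)
    obtain ⟨-, -, he', hμ'⟩ := hstep (s m) hM hI he (hbefore m hm)
    exact ⟨hbefore m hm, he', hμ'⟩
  · rw [hrun]
    obtain ⟨hM, -, he, -⟩ := hprop k hbefore
    have hr := milnorHilbertTwo_range hM he
    omega

/-! ## The nodes and the end of the spine -/

/-- [OURS · L1 W4.6 rung (ii) at `p = 2`, every dimension; NOT a statement of the manuscript] **CENSUS AT
A SPINE NODE**: at an isolated double state with `(e, h₂) = (2, 2)` (any field of characteristic `2`),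
every double successor is EITHER a satellite successor — corank `2`, isolated, `μ` drops, and its near
vector is proportional to that of ANY other corank-two successor (the spine continues at one point) — OR
a free leaf — corank `0`, isolated, `μ = 1`, no double point after it, and at most one such near point
(p544683). [folklore] -/
theorem hypersurface_spine_node_census [CharP κ 2] (c : (Fin n → ℕ) → κ) (hM : MultP 2 n κ c)
    (hI : Isol 2 n κ c) (he : milnorEmbDim 2 n κ c = 2) (hh : milnorHilbertTwo 2 n κ c = 2)
    (j : Fin n) (τ : Fin n → κ) (hM' : MultP 2 n κ (step 2 n κ j τ c)) :
    (milnorEmbDim 2 n κ (step 2 n κ j τ c) = 2 ∧ Isol 2 n κ (step 2 n κ j τ c) ∧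
        mu 2 n κ (step 2 n κ j τ c) < mu 2 n κ c ∧
        ∀ (j' : Fin n) (τ' : Fin n → κ), MultP 2 n κ (step 2 n κ j' τ' c) →
          milnorEmbDim 2 n κ (step 2 n κ j' τ' c) = 2 →
            ∃ r : κ, Function.update τ' j' 1 = r • Function.update τ j 1) ∨
      (milnorEmbDim 2 n κ (step 2 n κ j τ c) = 0 ∧ Isol 2 n κ (step 2 n κ j τ c) ∧
        mu 2 n κ (step 2 n κ j τ c) = 1 ∧
        (∀ (j' : Fin n) (τ' : Fin n → κ), ¬ MultP 2 n κ (step 2 n κ j' τ' (step 2 n κ j τ c))) ∧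
        ∀ (j' : Fin n) (τ' : Fin n → κ), MultP 2 n κ (step 2 n κ j' τ' c) →
          milnorEmbDim 2 n κ (step 2 n κ j' τ' c) = 0 →
            ∃ r : κ, Function.update τ' j' 1 = r • Function.update τ j 1) := by
  rcases hypersurface_successor_dichotomy_of_milnorHilbertTwo_le_two c hM hI he (by omega) j τ hM' with
    ⟨he', hI', hμ'⟩ | ⟨he', hI', hμ', hno⟩
  · exact Or.inl ⟨he', hI', hμ', fun j' τ' hM'' he'' =>
      hypersurface_satellite_successors_proportional c hM he (by omega) hM' hM'' he' he''⟩
  · exact Or.inr ⟨he', hI', hμ', hno, fun j' τ' hM'' he'' =>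
      hypersurface_free_successors_proportional c hM he (by omega) hM' hM'' he' he''⟩

/-- [OURS · L1 W4.6 rung (ii) at `p = 2`, every dimension; NOT a statement of the manuscript] **THE END
OF THE SPINE** (isolated corank-two double state, any field of characteristic `2`): if `h₂ = 1` then
`μ = 4`, there are at most THREE near double points and every double successor is a free leaf (corank
`0`, isolated, `μ = 1`, nothing after it); if `h₂ = 3` then EVERY double successor is NON-isolated, and
every non-zero kernel direction of the polar form is a near double point (a whole line `ℙ(ker P)` of
them) — the point-blow-up procedure leaves the isolated regime sideways. [folklore] -/
theorem hypersurface_spine_end [CharP κ 2] (c : (Fin n → ℕ) → κ) (hM : MultP 2 n κ c) (hI : Isol 2 n κ c)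
    (he : milnorEmbDim 2 n κ c = 2) :
    (milnorHilbertTwo 2 n κ c = 1 →
      mu 2 n κ c = 4 ∧
      (∃ S : Finset (Fin n → κ), S.card ≤ 3 ∧
        ∀ (j : Fin n) (τ : Fin n → κ), MultP 2 n κ (step 2 n κ j τ c) →
          ∃ w ∈ S, ∃ r : κ, Function.update τ j 1 = r • w) ∧
      ∀ (j : Fin n) (τ : Fin n → κ), MultP 2 n κ (step 2 n κ j τ c) →
        milnorEmbDim 2 n κ (step 2 n κ j τ c) = 0 ∧ Isol 2 n κ (step 2 n κ j τ c) ∧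
          mu 2 n κ (step 2 n κ j τ c) = 1 ∧
            ∀ (j' : Fin n) (τ' : Fin n → κ), ¬ MultP 2 n κ (step 2 n κ j' τ' (step 2 n κ j τ c))) ∧
    (milnorHilbertTwo 2 n κ c = 3 →
      (∀ (j : Fin n) (τ : Fin n → κ), MultP 2 n κ (step 2 n κ j τ c) → ¬ Isol 2 n κ (step 2 n κ j τ c)) ∧
      ∀ (w : Fin n → κ) (j : Fin n), Matrix.vecMul w (polarMatrix (ser 2 n κ c)) = 0 → w j ≠ 0 →
        MultP 2 n κ (step 2 n κ j ((w j)⁻¹ • w) c) ∧ ¬ Isol 2 n κ (step 2 n κ j ((w j)⁻¹ • w) c)) := by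
  refine ⟨fun h1 => ?_, fun h3 => ⟨fun j τ hM' => hypersurface_not_isol_step_of_milnorHilbertTwo_eq_three
    c j τ hM he h3 hM', fun w j hw hwj => hypersurface_whole_kernel_near_of_milnorHilbertTwo_eq_three
    c hM hI he h3 hw hwj⟩⟩
  obtain ⟨hS, hfree⟩ := hypersurface_near_census_of_milnorHilbertTwo_eq_one c hM hI he h1
  exact ⟨((hypersurface_milnorHilbertTwo_eq_one_iff c hM he).mp h1).2, hS, hfree⟩

/-- [OURS · L1 W4.6 rung (ii) at `p = 2`, EVERY dimension `n`, PERFECT field; NOT a statement of the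
manuscript] **THE CATERPILLAR**: the spine of `hypersurface_satellite_spine` together with the census at
its nodes and at its end — from an isolated `(2,2)` double point over a perfect field of characteristic
`2`, there are words `i, t` and `k ≥ 1`, `k + 4 ≤ μ(c₀)`, such that along `c_m = run c₀ i t m`: for
`m < k` every double successor of `c_m` is the next spine node `c_{m+1}` up to proportionality of near
vectors (corank `2`) or a free leaf (corank `0`, `μ = 1`, nothing after); and the end node `c_k` is a
three-tangents node (`μ = 4`, at most three free leaves, nothing else) or a no-tangent node (all double
successors non-isolated). [folklore] -/
theorem hypersurface_caterpillar [CharP κ 2] [PerfectField κ] (c₀ : (Fin n → ℕ) → κ)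
    (hM₀ : MultP 2 n κ c₀) (hI₀ : Isol 2 n κ c₀) (he₀ : milnorEmbDim 2 n κ c₀ = 2)
    (hh₀ : milnorHilbertTwo 2 n κ c₀ = 2) :
    ∃ (i : ℕ → Fin n) (t : ℕ → Fin n → κ) (k : ℕ), 1 ≤ k ∧ k + 4 ≤ mu 2 n κ c₀ ∧
      (∀ m < k, ∀ (j : Fin n) (τ : Fin n → κ), MultP 2 n κ (step 2 n κ j τ (run 2 n κ c₀ i t m)) →
        (milnorEmbDim 2 n κ (step 2 n κ j τ (run 2 n κ c₀ i t m)) = 2 ∧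
            ∃ r : κ, Function.update τ j 1 = r • Function.update (t m) (i m) 1) ∨
          (milnorEmbDim 2 n κ (step 2 n κ j τ (run 2 n κ c₀ i t m)) = 0 ∧
            mu 2 n κ (step 2 n κ j τ (run 2 n κ c₀ i t m)) = 1 ∧
            ∀ (j' : Fin n) (τ' : Fin n → κ),
              ¬ MultP 2 n κ (step 2 n κ j' τ' (step 2 n κ j τ (run 2 n κ c₀ i t m))))) ∧
      ((milnorHilbertTwo 2 n κ (run 2 n κ c₀ i t k) = 1 ∧ mu 2 n κ (run 2 n κ c₀ i t k) = 4 ∧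
          ∀ (j : Fin n) (τ : Fin n → κ), MultP 2 n κ (step 2 n κ j τ (run 2 n κ c₀ i t k)) →
            milnorEmbDim 2 n κ (step 2 n κ j τ (run 2 n κ c₀ i t k)) = 0 ∧
              mu 2 n κ (step 2 n κ j τ (run 2 n κ c₀ i t k)) = 1 ∧
              ∀ (j' : Fin n) (τ' : Fin n → κ),
                ¬ MultP 2 n κ (step 2 n κ j' τ' (step 2 n κ j τ (run 2 n κ c₀ i t k)))) ∨
        (milnorHilbertTwo 2 n κ (run 2 n κ c₀ i t k) = 3 ∧
          ∀ (j : Fin n) (τ : Fin n → κ), MultP 2 n κ (step 2 n κ j τ (run 2 n κ c₀ i t k)) →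
            ¬ Isol 2 n κ (step 2 n κ j τ (run 2 n κ c₀ i t k)))) := by
  obtain ⟨i, t, k, hk1, hk4, hnode, hspine, hend⟩ := hypersurface_satellite_spine c₀ hM₀ hI₀ he₀ hh₀
  refine ⟨i, t, k, hk1, hk4, fun m hm j τ hM' => ?_, ?_⟩
  · obtain ⟨hM, hI, he⟩ := hnode m hm.le
    obtain ⟨hh, he₁, -⟩ := hspine m hm
    have hM₁ : MultP 2 n κ (step 2 n κ (i m) (t m) (run 2 n κ c₀ i t m)) := by
      rw [← run_succ]; exact (hnode (m + 1) (by omega)).1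
    rw [run_succ] at he₁
    rcases hypersurface_spine_node_census _ hM hI he hh j τ hM' with
      ⟨he', -, -, hsat⟩ | ⟨he', -, hμ', hno, -⟩
    · refine Or.inl ⟨he', ?_⟩
      obtain ⟨r, hr⟩ := hsat (i m) (t m) hM₁ he₁
      -- `hr : update (t m) (i m) 1 = r • update τ j 1`; invert the non-zero scalar
      have hr0 : r ≠ 0 := by
        intro h0
        rw [h0, zero_smul] at hr
        exact update_one_ne_zero (t m) (i m) hr
      exact ⟨r⁻¹, by rw [hr, smul_smul, inv_mul_cancel₀ hr0, one_smul]⟩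
    · exact Or.inr ⟨he', hμ', hno⟩
  · obtain ⟨hM, hI, he⟩ := hnode k le_rfl
    obtain ⟨h1, h3⟩ := hypersurface_spine_end _ hM hI he
    rcases hend with hh1 | hh3
    · obtain ⟨hμ, -, hfree⟩ := h1 hh1
      exact Or.inl ⟨hh1, hμ, fun j τ hM' =>
        let ⟨he', _, hμ', hno⟩ := hfree j τ hM'
        ⟨he', hμ', hno⟩⟩
    · exact Or.inr ⟨hh3, (h3 hh3).1⟩

end CampaignW46.HypersurfacesCharTwo

end Summit.ResolutionOfSingularities.ResolutionOfSingularities.Theorems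

end
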